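import Literature.AlgebraicTopology.SingularHomology.StdSimplexFaces
import Literature.AlgebraicTopology.Homotopy.WhiteheadCWContractible
import Literature.AlgebraicTopology.Homotopy.SimplexBallHomeomorph
import HarnessLib

/-!
# Box filling over the standard simplex: `Δ^q × [0,1]` from bottom and sides

Topic `Literature/AlgebraicTopology/SingularHomology`. The homotopy-extension step of the
Eilenberg compression argument behind the Hurewicz theorem (used in `HurewiczCompression.lean`,
forthcoming): given a map `φ` on the bottom `Δ^q × {0}` of the prism and a map `h` on its sides
`∂Δ^q × [0, 1]`, the latter constant `= x₀` from time `τ` on, and GIVEN that every map of the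
cube `I^q` into `X` which is constant `= x₀` on `∂I^q` is null-homotopic rel `∂I^q`
(`π_q(X, x₀) = 0` in Mathlib's cubical model; path-connectedness to `x₀` for `q = 0`), the two
extend to the solid prism `Δ^q × [0, 1]`, with value `x₀` from any later time `τ' > τ` on
(`exists_simplex_box_extension`). This is A. Hatcher, *Algebraic Topology*, CUP 2002, Lemma 4.7
(extension lemma) / Prop. 0.16 for the cell `Δ^q`, and is obtained here by TRANSPORT of the cube
version already in the tree, `Literature.AlgebraicTopology.Homotopy.WhiteheadCW.exists_box_extension`
(box filling over the sup-norm ball `[-1, 1]^q` by radial projection), along the homeomorphism of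
pairs `(Δ^q, ∂Δ^q) ≅ (D^q, ∂D^q)` of `Literature.AlgebraicTopology.Homotopy.SimplexBall.toBall`
(`SimplexBallHomeomorph.lean`):

* `SimplexChart.ofBall q : ℝ^q → Δ^q` — the inverse chart `toBall.symm` extended (by a junk value)
  off the closed unit ball, so that side data on `∂D^q × [0,1]` can be written as a function on
  the ambient box, as `WhiteheadCW.exists_box_extension` wants; its continuity on the ball and
  the matching of `∂Δ^q = stdBoundary q` with the unit sphere;
* `exists_simplex_box_extension` — the box filling over `Δ^q`.

Everything is proved; no named facts. [folklore] throughout (Hatcher 2002, Prop. 0.16 and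
Lemma 4.7 for the geometric content).

## References

* A. Hatcher, *Algebraic Topology*, CUP 2002, Prop. 0.16, Lemma 4.7 (p. 348). [HatcherAT2002]
-/

noncomputable section

open Set Metric
open Literature.AlgebraicTopology.Homotopy (SimplexBall.toBall SimplexBall.toBall_mem_sphere_iff
  SimplexBall.exists_toBall_symm_apply_eq_zero_iff)

universe u

namespace Literature.AlgebraicTopology.SingularHomology

namespace SimplexChart

variable (q : ℕ)

/-- The chart `Δ^q → D^q` (sup-norm closed unit ball of `ℝ^q`) of `SimplexBall.toBall`, as a map
to the ambient space. [folklore] -/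
def toBall (y : StdSimplex q) : Fin q → ℝ := (SimplexBall.toBall q y : Fin q → ℝ)

/-- The chart is continuous. [folklore] -/
lemma continuous_toBall : Continuous (toBall q) :=
  continuous_subtype_val.comp (SimplexBall.toBall q).continuous

/-- The chart lands in the closed unit ball. [folklore] -/
lemma toBall_mem_closedBall (y : StdSimplex q) : toBall q y ∈ closedBall (0 : Fin q → ℝ) 1 :=
  (SimplexBall.toBall q y).2

/-- The chart maps `∂Δ^q` into the unit sphere. [folklore] -/
lemma toBall_mem_sphere {y : StdSimplex q} (hy : y ∈ stdBoundary q) :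
    toBall q y ∈ sphere (0 : Fin q → ℝ) 1 :=
  (SimplexBall.toBall_mem_sphere_iff q y).2 hy

open Classical in
/-- **The inverse chart** `D^q → Δ^q` (`SimplexBall.toBall.symm`, extended by a junk value off the
ball). [folklore] -/
def ofBall (w : Fin q → ℝ) : StdSimplex q :=
  if hw : w ∈ closedBall (0 : Fin q → ℝ) 1 then (SimplexBall.toBall q).symm ⟨w, hw⟩
  else (SimplexBall.toBall q).symm ⟨0, mem_closedBall_self zero_le_one⟩

/-- The inverse chart on the ball is `toBall.symm`. [folklore] -/
lemma ofBall_of_mem {w : Fin q → ℝ} (hw : w ∈ closedBall (0 : Fin q → ℝ) 1) :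
    ofBall q w = (SimplexBall.toBall q).symm ⟨w, hw⟩ := by
  rw [ofBall, dif_pos hw]

/-- The inverse chart is continuous on the closed ball. [folklore] -/
lemma continuousOn_ofBall : ContinuousOn (ofBall q) (closedBall 0 1) := by
  rw [continuousOn_iff_continuous_restrict]
  have h : (closedBall (0 : Fin q → ℝ) 1).restrict (ofBall q) =
      fun w : closedBall (0 : Fin q → ℝ) 1 => (SimplexBall.toBall q).symm w := by
    funext w
    exact ofBall_of_mem q w.2
  rw [h]
  exact (SimplexBall.toBall q).symm.continuous

/-- `ofBall ∘ toBall = id` on `Δ^q`. [folklore] -/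
lemma ofBall_toBall (y : StdSimplex q) : ofBall q (toBall q y) = y := by
  rw [ofBall_of_mem q (toBall_mem_closedBall q y)]
  exact (SimplexBall.toBall q).symm_apply_apply y

/-- `toBall ∘ ofBall = id` on the closed ball. [folklore] -/
lemma toBall_ofBall {w : Fin q → ℝ} (hw : w ∈ closedBall (0 : Fin q → ℝ) 1) :
    toBall q (ofBall q w) = w := by
  rw [ofBall_of_mem q hw, toBall, Homeomorph.apply_symm_apply]

/-- The inverse chart maps the unit sphere into `∂Δ^q`. [folklore] -/
lemma ofBall_mem_stdBoundary {w : Fin q → ℝ} (hw : w ∈ sphere (0 : Fin q → ℝ) 1) :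
    ofBall q w ∈ stdBoundary q := by
  rw [ofBall_of_mem q (sphere_subset_closedBall hw)]
  exact (SimplexBall.exists_toBall_symm_apply_eq_zero_iff q ⟨w, sphere_subset_closedBall hw⟩).2 hw

end SimplexChart

/-! ### The box filling over the simplex -/

open SimplexChart unitInterval in
/-- **Box filling over `Δ^q`** (Hatcher 2002, Lemma 4.7 / Prop. 0.16 for the cell `Δ^q`), GIVEN
that every map of the cube `I^q` into `X` which is constant `= x₀` on `∂I^q` is null-homotopic
rel `∂I^q` (`π_q(X, x₀) = 0`; for `q = 0`: the point is joined to `x₀` by a path): a continuous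
`φ` on the bottom `Δ^q × {0}` and an `h` continuous on the sides `∂Δ^q × [0, 1]`, agreeing on the
rim `∂Δ^q × {0}` and with `h = x₀` from time `τ` on, extend to `G` continuous on `Δ^q × [0, 1]`
with `G = x₀` from time `τ' > τ` on. Transported from the cube version
`WhiteheadCW.exists_box_extension` along the chart `(Δ^q, ∂Δ^q) ≅ (D^q, ∂D^q)`. [folklore] -/
theorem exists_simplex_box_extension {X : Type u} [TopologicalSpace X] (x₀ : X) {q : ℕ}
    {τ τ' : ℝ} (hτ : 0 < τ) (hττ' : τ < τ') (hτ'1 : τ' ≤ 1)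
    (hπ : ∀ ψ : C(Fin q → I, X), (∀ y ∈ Cube.boundary (Fin q), ψ y = x₀) →
      ψ.HomotopicRel (ContinuousMap.const _ x₀) (Cube.boundary (Fin q)))
    {φ : StdSimplex q → X} (hφ : Continuous φ)
    {h : StdSimplex q × ℝ → X} (hh : ContinuousOn h (stdBoundary q ×ˢ Icc (0 : ℝ) 1))
    (h0 : ∀ y ∈ stdBoundary q, h (y, 0) = φ y)
    (hlate : ∀ y ∈ stdBoundary q, ∀ t ∈ Icc τ 1, h (y, t) = x₀) :
    ∃ G : StdSimplex q × ℝ → X, ContinuousOn G (univ ×ˢ Icc (0 : ℝ) 1) ∧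
      (∀ y, G (y, 0) = φ y) ∧
      (∀ y ∈ stdBoundary q, ∀ t ∈ Icc (0 : ℝ) 1, G (y, t) = h (y, t)) ∧
      (∀ y, ∀ t ∈ Icc τ' 1, G (y, t) = x₀) := by
  -- transport the data to the ball
  set φ' : (Fin q → ℝ) → X := fun w => φ (ofBall q w) with hφ'
  set h' : (Fin q → ℝ) × ℝ → X := fun p => h (ofBall q p.1, p.2) with hh'def
  have hφ'c : ContinuousOn φ' (closedBall 0 1) := hφ.comp_continuousOn (continuousOn_ofBall q)
  have hmaps : MapsTo (fun p : (Fin q → ℝ) × ℝ => (ofBall q p.1, p.2))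
      (sphere (0 : Fin q → ℝ) 1 ×ˢ Icc (0 : ℝ) 1) (stdBoundary q ×ˢ Icc (0 : ℝ) 1) :=
    fun p hp => ⟨ofBall_mem_stdBoundary q hp.1, hp.2⟩
  have hh'c : ContinuousOn h' (sphere (0 : Fin q → ℝ) 1 ×ˢ Icc (0 : ℝ) 1) := by
    refine hh.comp ?_ hmaps
    exact ((continuousOn_ofBall q).comp continuousOn_fst fun p hp =>
      sphere_subset_closedBall hp.1).prodMk continuousOn_snd
  have h0' : ∀ w ∈ sphere (0 : Fin q → ℝ) 1, h' (w, 0) = φ' w :=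
    fun w hw => h0 _ (ofBall_mem_stdBoundary q hw)
  have hlate' : ∀ w ∈ sphere (0 : Fin q → ℝ) 1, ∀ t ∈ Icc τ 1, h' (w, t) = x₀ :=
    fun w hw t ht => hlate _ (ofBall_mem_stdBoundary q hw) t ht
  obtain ⟨G', hG'c, hG'0, hG's, hG'l⟩ :=
    Literature.AlgebraicTopology.Homotopy.WhiteheadCW.exists_box_extension x₀ hτ hττ' hτ'1 hπ hφ'c
      hh'c h0' hlate'
  refine ⟨fun p => G' (toBall q p.1, p.2), ?_, ?_, ?_, ?_⟩
  · refine hG'c.comp (((continuous_toBall q).comp continuous_fst).prodMk continuous_snd).continuousOn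
      ?_
    exact fun p hp => ⟨toBall_mem_closedBall q p.1, hp.2⟩
  · intro y
    change G' (toBall q y, 0) = φ y
    rw [hG'0 _ (toBall_mem_closedBall q y)]
    change φ (ofBall q (toBall q y)) = φ y
    rw [ofBall_toBall]
  · intro y hy t ht
    change G' (toBall q y, t) = h (y, t)
    rw [hG's _ (toBall_mem_sphere q hy) t ht]
    change h (ofBall q (toBall q y), t) = h (y, t)
    rw [ofBall_toBall]
  · intro y t ht
    exact hG'l _ (toBall_mem_closedBall q y) t ht

end Literature.AlgebraicTopology.SingularHomology
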